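import Summits.BirchSwinnertonDyer.BirchSwinnertonDyer.Theorems.ClassRecordThreeShimuraKolyvaginOrderBoundAtThreeSurjHOfCarrier
import Summits.BirchSwinnertonDyer.BirchSwinnertonDyer.Theorems.ClassRecordThreeShimuraKolyvaginOrderBoundAtThreeSurjTransport
import Literature.NumberTheory.EllipticCurves.HeegnerPointFiniteIndex
import HarnessLib

/-!
# Crux `ShimuraKolyvaginOrderBoundAtThreeSurj` (item stmt-BirchSwinnertonDyer-19899) — stub H from the INDEX-FREE
# supplier: `0 < [E(K):ℤy]` is NOT a printed input of H but a consequence of the display, Gross–Zagier–Kolyvagin over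
# `ℚ` and modularity (Theses-free part)

Cell `bsd-stepL` (run/shared/lean/pub/bsd-stepL/), seat `bsd-stepL-shim3a` (prover g3), HELPER for the shared crux
(`--supports stmt-BirchSwinnertonDyer-19899 --as helper`; K2@3 `route-BirchSwinnertonDyer-ClassRecordThree` + KOLY
`route-BirchSwinnertonDyer-KolyvaginRoadThree`; skeleton v3 b5621f5fb3bef0cc). Sequel of `…SurjHOfCarrier.lean`
(p493558): there the supplier binder `hCar` (the `p = 3` twin of shim-p1's p484436 binder) carries the clause
`0 < (AddSubgroup.zmultiples y).index` UNGUARDED — the clause referee g38 scored SMUGGLED(clause) in the 19718-S1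
supplier (VERDICT-SUPPLIER-19718-g38.md, 2026-08-27T03:49Z: unguarded it asserts «`L′(E/K,1) = 0 ⇒ E(K)` finite»
across the family; Nekovář 2007 Thm. (3.2) is conditional on `y` non-torsion). THIS FILE deletes the clause from the
supplier instead of guarding it. Stub H asks the order bound only for NON-TORSION displayed points; for such a `y`
(`L′(E/K,1) = c·ĥ(y)/degy`, `c ≠ 0` by Petersson positivity — `ShimuraKolyvaginSurjTransport.displayConstant_ne_zero`)
`L′(E/K,1) ≠ 0`, so Gross–Zagier–Kolyvagin over `ℚ` for `E` and `E^{(d_K)}` and modularity give `rank E(K) = 1`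
(shim3a g0's `ShimuraKolyvaginTransport.mordellWeilRank_baseChange_eq_one_of_LDerivEK_ne_zero`, p468392), hence
`[E(K):ℤy]` is finite and positive (`index_zmultiples_ne_zero_of_finrank_eq_one`; Mordell–Weil a tree theorem). The
two inputs are conjuncts 6 (`rank_eq_analyticRank_of_analyticRank_le_one`) and 7 (`hasEntireLFunction_rat`) of
`PublishedInputsThree` = `PublishedInputsKolyThree.1` (the Theses-importing sequel `…SurjOfCarrierIndexFree.lean`
binds them BY NAME), so the supplier statement a planner would HOLD as the Shimura-carrier aside at `p = 3` has NO
index clause at all — nothing to guard, nothing to smuggle. The same lemma repairs 19718-S1 at `p ≥ 5` (it is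
`p`-free).

## What is proved (theorems only; no `def`, no named fact, no `sorry`)

* `index_pos_of_display_of_GZK` — `0 < [E(K):ℤy]` for a displayed non-torsion `y ∈ E(K)`, `K` imaginary quadratic,
  from GZK over `ℚ` + modularity.
* `stub_orderBoundSurj_heegnerPointAtThree_of_indexFreeCarrier_of_casselsTate_of_GZK_of_poitouTate` — stub H
  (registered signature VERBATIM) ⟸ {`hCarF`, `hCT`, `hPT`, `hGZK`, `hE`} (all ∀-statements; pack-free), where
  `hCarF` = `hCar` of p493558 WITHOUT the index clause and `hCT` = the levelwise Cassels–Tate inputs of p493558.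

HONEST FRAMING: CONDITIONAL on the binders; nothing about `X_{N⁺,N⁻}` is constructed; item 19899 stays OPEN; BSD is
not proved by any of this; no census number moves (T7).
[cite: Darmon2004, Thm. 3.22] [cite: BCDTJAMS2001, Thm. A] [cite: SilvermanAEC2009, Thm. VIII.9.3, VIII.6]
[cite: CaiShuTian2014, Thm. 1.5] [cite: McCallumLMS1991, §1 Theorem (Kolyvagin)] [cite: MilneADT2006, Ch. I Thm. 4.10(b), §6 Thm. 6.13(a)]
[cite: Nekovar2007, Thm. (3.2), (4.8)–(4.13)] [cite: BertoliniDarmon1996, §2.3–2.6, Prop. 2.6] [cite: JetchevSkinnerWan2017, Thm. 4.4.1 (p. 19)]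
presearch: as `…SurjHOfCarrier`; `lean search 'index_zmultiples_ne_zero_of_finrank_eq_one'` → Literature/…/HeegnerPointFiniteIndex (reused, not restated).
-/

noncomputable section

open scoped Classical AddSubgroup
set_option linter.dupNamespace false
namespace Summit.BirchSwinnertonDyer.BirchSwinnertonDyer.Theorems.ShimuraKolyvaginSurjHOfCarrierIndexFree

open WeierstrassCurve NumberField IsDedekindDomain Field Function CongruenceSubgroup
  Literature.NumberTheory.Automorphic Literature.NumberTheory.EllipticCurves.ModularForms
  Literature.NumberTheory.EllipticCurves Literature.NumberTheory.EllipticCurves.KolyvaginCocycle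
  Literature.NumberTheory.EllipticCurves.KolyvaginDescent
  Literature.NumberTheory.EllipticCurves.RingClassField
  Literature.NumberTheory.GaloisRepresentations Literature.NumberTheory.GaloisCohomology
  Literature.NumberTheory.NumberFields Literature.NumberTheory.DiophantineGeometry
  Summit.BirchSwinnertonDyer.Rank1Residual.X11b
  Summit.BirchSwinnertonDyer.BirchSwinnertonDyer.Theorems
  Summit.BirchSwinnertonDyer.BirchSwinnertonDyer.Theorems.ShimuraKolyvaginSurjHOfCarrier
  Summit.BirchSwinnertonDyer.BirchSwinnertonDyer.Theorems.ShimuraKolyvaginSurjTransport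
  Summit.BirchSwinnertonDyer.BirchSwinnertonDyer.Theorems.ShimuraKolyvaginTransport
open Literature.NumberTheory.GaloisRepresentations.DiscreteGaloisModule (mu MuCarrier)

/-! ### §1. Positive index from the display -/

/-- **`0 < [E(K):ℤy]` for a Gross–Zagier-displayed non-torsion point**: `L′(E/K,1) = c·ĥ(y)/degy` with the non-zero
constant `c = 8π²(f,f)/((w_K/2)²√|d_K|)` (`displayConstant_ne_zero`), `degy ≥ 1` and `ĥ(y) ≠ 0` give
`L′(E/K,1) ≠ 0`; Gross–Zagier–Kolyvagin over `ℚ` (for `E` and `E^{(d_K)}`) and modularity give `rank E(K) = 1`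
(`mordellWeilRank_baseChange_eq_one_of_LDerivEK_ne_zero`, p468392); a non-torsion point of a rank-one finitely
generated group has finite, hence positive, index (`index_zmultiples_ne_zero_of_finrank_eq_one`). CONDITIONAL on the
two named facts `hGZK`, `hE`. [cite: Darmon2004, Thm. 3.22] [cite: BCDTJAMS2001, Thm. A] [cite: SilvermanAEC2009, Thm. VIII.9.3] -/
theorem index_pos_of_display_of_GZK
    (hGZK : rank_eq_analyticRank_of_analyticRank_le_one) (hE : WeierstrassCurve.hasEntireLFunction_rat)
    (W : WeierstrassCurve ℚ) [W.IsElliptic] {N : ℕ} [NeZero N] (Dt : ModularParametrizationData W N)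
    (K : Type) [Field K] [NumberField K] (hK : IsImaginaryQuadratic K)
    {y : (W.baseChange K).toAffine.Point} {degy : ℕ} (h0 : 0 < degy)
    (hdisp : LDerivEK W K =
        8 * (Real.pi : ℂ) ^ 2 * peterssonProduct (Gamma0 N) 2 Dt.f Dt.f /
            ((((Units.torsionOrder K : ℝ) / 2) ^ 2 * √|(NumberField.discr K : ℝ)| : ℝ) : ℂ) *
          ((y.canonicalHeight : ℂ) / (degy : ℂ)))
    (hnt : ¬ IsOfFinAddOrder y) :
    0 < (AddSubgroup.zmultiples y).index := by
  haveI hEK : (W.baseChange K).IsElliptic := by rw [WeierstrassCurve.baseChange]; infer_instance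
  -- `L′(E/K,1) ≠ 0`
  have hc := displayConstant_ne_zero Dt K
  have hh : (y.canonicalHeight : ℂ) ≠ 0 := by
    have hhR : y.canonicalHeight ≠ 0 := fun h ↦
      hnt ((WeierstrassCurve.Affine.Point.canonicalHeight_eq_zero_iff_holds y).mp h)
    exact_mod_cast hhR
  have hdeg : (degy : ℂ) ≠ 0 := by exact_mod_cast h0.ne'
  have hL : LDerivEK W K ≠ 0 := by
    rw [hdisp]
    exact mul_ne_zero hc (div_ne_zero hh hdeg)
  -- rank one, then finite index
  have hrK : (W.baseChange K).mordellWeilRank = 1 :=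
    mordellWeilRank_baseChange_eq_one_of_LDerivEK_ne_zero W K hGZK hE hK.1 hL hnt
  haveI : AddGroup.FG (W.baseChange K).toAffine.Point := (W.baseChange K).addGroup_fg_point_holds
  exact Nat.pos_of_ne_zero (index_zmultiples_ne_zero_of_finrank_eq_one hnt hrK)

section Binders

/-! ### §2. The INDEX-FREE supplier and the levelwise Cassels–Tate binder, declared once -/

variable
  (hCarF : ∀ (W : WeierstrassCurve ℚ) [W.IsElliptic] [W.IsGloballyMinimal] (p : ℕ) [Fact p.Prime]
    (N : ℕ) [NeZero N] (K : Type) [Field K] [NumberField K] (S : Finset ℕ)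
    (Dt : ModularParametrizationData W N)
    (X : ShimuraCurveData (∏ q ∈ S, q) (N / ∏ q ∈ S, q))
    (W' : WeierstrassCurve ℚ) [W'.IsElliptic] (P₀ : ShimuraParametrizationData X W'),
    W.conductorNorm ℤ = N → Literature.NumberTheory.EllipticCurves.Rank1Residual.Surj W 3 →
    p ≠ 2 → W.HasIrreducibleModPGaloisRep p →
    IsImaginaryQuadratic K → Even S.card →
    (∀ ℓ ∈ S, ℓ.Prime ∧ ℓ ∣ N ∧ ¬ ℓ ^ 2 ∣ N ∧
      ((Ideal.span {(ℓ : ℤ)}).primesOver (𝓞 K)).ncard = 1 ∧ ¬ (ℓ : ℤ) ∣ NumberField.discr K) →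
    (∀ ℓ : ℕ, ℓ.Prime → ℓ ∣ N → ℓ ∉ S → ((Ideal.span {(ℓ : ℤ)}).primesOver (𝓞 K)).ncard = 2) →
    ((Ideal.span {(p : ℤ)}).primesOver (𝓞 K)).ncard = 2 →
    P₀.IsMinimalFor W →
    p ∣ N → p = 3 →
    ∃ (ι : K →+* ℂ) (y : (W.baseChange K).toAffine.Point) (degy : ℕ), 0 < degy ∧
      padicValNat p degy = padicValNat p P₀.deg ∧
      LDerivEK W K =
          8 * (Real.pi : ℂ) ^ 2 * peterssonProduct (Gamma0 N) 2 Dt.f Dt.f /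
              ((((Units.torsionOrder K : ℝ) / 2) ^ 2 * √|(NumberField.discr K : ℝ)| : ℝ) : ℂ) *
            ((y.canonicalHeight : ℂ) / (degy : ℂ)) ∧
      ∀ (k : ℕ) {M : ℕ} (_hM : 1 ≤ M)
        (hdiv : ∀ Q : geomPoints (W.baseChange K), ∃ R, ((p ^ M : ℕ) : ℤ) • R = Q)
        (c : K ≃ₐ[ℚ] K) (_hc : c ≠ 1),
        ∃ (ε : ℤ) (τ : AlgebraicClosure K ≃+* AlgebraicClosure K) (hτ : IsLiftOfAut c τ)
          (A : ℕ → AddSubgroup (geomPoints (W.baseChange K)))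
          (hA : ∀ m, KolyvaginCocycle.IsAdmissible (Field.absoluteGaloisGroup K) (A m)
            ((p ^ M : ℕ) : ℤ))
          (emb : ∀ m : ℕ, ringClassField K ι m →ₐ[K] AlgebraicClosure K)
          (Pt : ℕ → geomPoints (W.baseChange K))
          (hPt : ∀ m, Pt m ∈
            KolyvaginCocycle.invPoints (Field.absoluteGaloisGroup K) (A m) ((p ^ M : ℕ) : ℤ)),
          (ε = 1 ∨ ε = -1) ∧
          IsOfFinAddOrder (Affine.Point.map (W' := W) (c : K →ₐ[ℚ] K) y - ε • y) ∧
          (∀ m, ∀ a ∈ A m, hτ.pointsMap W a ∈ A m) ∧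
          Pt 1 = toGeomPoints (W.baseChange K) y ∧
          (∀ m, m ≠ 0 → ∀ a ∈ A m, ∀ Φ : Field.absoluteGaloisGroup K,
            (∀ x : ringClassField K ι m, Φ • emb m x = emb m x) → Φ • a = a) ∧
          (∀ m, KolyvaginCocycle.IsAdmissible (Field.absoluteGaloisGroup K) (A m)
            ((p ^ (M + k) : ℕ) : ℤ)) ∧
          (∀ m : ℕ, Squarefree m →
            (∀ q ∈ m.primeFactors,
              IsKolyvaginPrime N W K p q ∧ FrobEqFrobInfty W K (p ^ (M + k)) q) →
            Pt m ∈ KolyvaginCocycle.invPoints (Field.absoluteGaloisGroup K) (A m)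
              ((p ^ (M + k) : ℕ) : ℤ) ∧
            (∃ B ∈ A m, hτ.pointsMap W (Pt m) =
              (ε * (-1) ^ m.primeFactors.card) • Pt m + ((p ^ M : ℕ) : ℤ) • B) ∧
            (∀ ℓ : ℕ, ℓ.Prime → ℓ ∣ m → ∀ v : HeightOneSpectrum (𝓞 K), (ℓ : 𝓞 K) ∈ v.asIdeal →
              ∀ a : ℕ, (((p : ℤ) ^ a) •
                  kolyvaginClass (W.baseChange K) _ hdiv (hA m) (Pt m) (hPt m) ∈
                  selmerLocalKer (W.baseChange K) (v.adicCompletion K) ((p ^ M : ℕ) : ℤ) ↔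
                ((p : ℤ) ^ a) • kolyvaginClass (W.baseChange K) _ hdiv (hA (m / ℓ)) (Pt (m / ℓ))
                    (hPt (m / ℓ)) ∈
                  (W.baseChange K).torsionLocalKer (v.adicCompletion K) ((p ^ M : ℕ) : ℤ)))))
  (hCT : ∀ (K : Type) [Field K] [NumberField K] (W : WeierstrassCurve ℚ) [W.IsElliptic] (p M₀ : ℕ),
    p.Prime → p ≠ 2 → 1 ≤ M₀ → ∀ [NeZero (p ^ M₀)] (c : K ≃ₐ[ℚ] K), c ≠ 1 → c * c = 1 →
    ∀ (e : geomTorsion (W.baseChange K) ((p ^ M₀ * p ^ M₀ : ℕ) : ℤ) →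
        geomTorsion (W.baseChange K) ((p ^ M₀ * p ^ M₀ : ℕ) : ℤ) → AlgebraicClosure K)
      (hμ : ∀ S T, e S T ^ (p ^ M₀ * p ^ M₀) = 1)
      (hadd₁ : ∀ S₁ S₂ T, e (S₁ + S₂) T = e S₁ T * e S₂ T)
      (hadd₂ : ∀ S T₁ T₂, e S (T₁ + T₂) = e S T₁ * e S T₂)
      (hgal : ∀ (σ : absoluteGaloisGroup K)
        (S T : geomTorsion (W.baseChange K) ((p ^ M₀ * p ^ M₀ : ℕ) : ℤ)), σ • e S T = e (σ • S) (σ • T))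
      (halt : ∀ T, e T T = 1), (∀ T, (∀ S, e S T = 1) → T = 0) →
    ∃ (inv : LocalInvariants K (p ^ M₀ * p ^ M₀)) (hPT' : inv.SumInvLocalizationEqZero)
      (hH3 : ∀ x : galoisCohomology (mu K (p ^ M₀ * p ^ M₀)) 3,
        (∀ v : Place K, galoisCohomology.localization (mu K (p ^ M₀ * p ^ M₀)) v 3 x = 0) → x = 0),
      (∀ v : HeightOneSpectrum (𝓞 K), Injective (inv (Sum.inr v))) ∧
      Literature.GroupTheory.FiniteAbelian.IsLevelPairing (p ^ M₀)
        (ctLevelPairing (W.baseChange K) (p ^ M₀) e hμ hadd₁ hadd₂ hgal inv halt hPT' hH3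
          (localTerm_finite_support (W := W.baseChange K) (m := p ^ M₀) (e := e) (hμ := hμ)
            (hadd₁ := hadd₁) (hadd₂ := hadd₂) (hgal := hgal) halt inv)) ∧
      (∀ z ∈ selmerGroup (W.baseChange K) ((p ^ M₀ * p ^ M₀ : ℕ) : ℤ),
        ∀ t ∈ selmerGroup (W.baseChange K) ((p ^ M₀ * p ^ M₀ : ℕ) : ℤ),
        ctGeneralFun (W.baseChange K) (p ^ M₀) e hμ hadd₁ hadd₂ hgal inv
            (torsionH1ToH1 (W.baseChange K) _ (conjAct W c _ z))
            (torsionH1ToH1 (W.baseChange K) _ (conjAct W c _ t)) =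
          ctGeneralFun (W.baseChange K) (p ^ M₀) e hμ hadd₁ hadd₂ hgal inv
            (torsionH1ToH1 (W.baseChange K) _ z) (torsionH1ToH1 (W.baseChange K) _ t)))

include hCarF hCT

/-- **Stub H `stub_orderBoundSurj_heegnerPointAtThree` (registered signature VERBATIM) from Poitou–Tate `hPT`,
Gross–Zagier–Kolyvagin over `ℚ` `hGZK`, modularity `hE`, the levelwise Cassels–Tate inputs `hCT` and the INDEX-FREE
displayed Shimura carrier `hCarF` at `p = 3`.** The witness is the supplier's `y`; under H's own non-torsion
antecedent `0 < [E(K):ℤy]` is `index_pos_of_display_of_GZK`, and the bound is p493558's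
`natCard_sha_three_primary_le_pow_index_of_carrier_of_casselsTate_of_poitouTate`. HONEST: conditional; H as registered
stays OPEN. [cite: JetchevSkinnerWan2017, Thm. 4.4.1 (p. 19)] [cite: McCallumLMS1991, §1 Theorem (Kolyvagin)]
[cite: MilneADT2006, Ch. I Thm. 4.10(b), §6 Thm. 6.13(a)] [cite: Darmon2004, Thm. 3.22] [cite: BCDTJAMS2001, Thm. A] -/
theorem stub_orderBoundSurj_heegnerPointAtThree_of_indexFreeCarrier_of_casselsTate_of_GZK_of_poitouTate
    (hPT : ∀ (K : Type) [Field K] [NumberField K], poitouTate_sum_localTatePairing_eq_zero K)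
    (hGZK : rank_eq_analyticRank_of_analyticRank_le_one) (hE : WeierstrassCurve.hasEntireLFunction_rat) :
  ∀ (W : WeierstrassCurve ℚ) [W.IsElliptic] [W.IsGloballyMinimal] (p : ℕ) [Fact p.Prime]
    (N : ℕ) [NeZero N] (K : Type) [Field K] [NumberField K] (S : Finset ℕ)
    (Dt : ModularParametrizationData W N)
    (X : ShimuraCurveData (∏ q ∈ S, q) (N / ∏ q ∈ S, q))
    (W' : WeierstrassCurve ℚ) [W'.IsElliptic] (P₀ : ShimuraParametrizationData X W'),
    W.conductorNorm ℤ = N → Literature.NumberTheory.EllipticCurves.Rank1Residual.Surj W 3 →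
    p ≠ 2 → W.HasIrreducibleModPGaloisRep p →
    IsImaginaryQuadratic K → Even S.card →
    (∀ ℓ ∈ S, ℓ.Prime ∧ ℓ ∣ N ∧ ¬ ℓ ^ 2 ∣ N ∧
      ((Ideal.span {(ℓ : ℤ)}).primesOver (𝓞 K)).ncard = 1 ∧ ¬ (ℓ : ℤ) ∣ NumberField.discr K) →
    (∀ ℓ : ℕ, ℓ.Prime → ℓ ∣ N → ℓ ∉ S → ((Ideal.span {(ℓ : ℤ)}).primesOver (𝓞 K)).ncard = 2) →
    ((Ideal.span {(p : ℤ)}).primesOver (𝓞 K)).ncard = 2 →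
    P₀.IsMinimalFor W →
    p ∣ N → p = 3 →
    ∃ (P : (W.baseChange K).toAffine.Point) (degS : ℕ), 0 < degS ∧
      padicValNat p degS = padicValNat p P₀.deg ∧
      LDerivEK W K =
          8 * (Real.pi : ℂ) ^ 2 * peterssonProduct (Gamma0 N) 2 Dt.f Dt.f /
              ((((Units.torsionOrder K : ℝ) / 2) ^ 2 * √|(NumberField.discr K : ℝ)| : ℝ) : ℂ) *
            ((P.canonicalHeight : ℂ) / (degS : ℂ)) ∧
      (¬ IsOfFinAddOrder P →
        Nat.card (AddCommGroup.primaryComponent (W.baseChange K).sha p) ≤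
            p ^ (2 * padicValNat p (AddSubgroup.zmultiples P).index)) := by
  intro W _ _ p _ N _ K _ _ S Dt X W' _ P₀ hN hsurj hp2 hirr hK hS hin hsp hps hmin hpN hp3
  obtain ⟨ι, y, degy, h0y, hvy, hLy, hcar⟩ :=
    hCarF W p N K S Dt X W' P₀ hN hsurj hp2 hirr hK hS hin hsp hps hmin hpN hp3
  subst hp3
  refine ⟨y, degy, h0y, hvy, hLy, fun hnt ↦ ?_⟩
  exact natCard_sha_three_primary_le_pow_index_of_carrier_of_casselsTate_of_poitouTate (hPT K) hCT W hN hsurj hK ι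
    hin hsp hnt (index_pos_of_display_of_GZK hGZK hE W Dt K hK h0y hLy hnt) hcar

end Binders

end Summit.BirchSwinnertonDyer.BirchSwinnertonDyer.Theorems.ShimuraKolyvaginSurjHOfCarrierIndexFree

end
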